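import Literature.Probability.LatticeModels.CoexistenceAnchoring
import Literature.Probability.LatticeModels.PinLeftBound
import Literature.Probability.LatticeModels.TouchingProbability
import HarnessLib

/-!
# Good paths of upper type in the coexistence case (GH2000 Lemma 5.5, Case 3, winding form)

Topic `Probability/LatticeModels`; theorems only. Georgii–Higuchi, J. Math. Phys. 41 (2000), proof of
Lemma 5.5, Case 3 (`μ(E⁺_up) = μ(E⁻_up) = 1`): "consider the half-plane `{x₂ ≥ -n}` containing `Δ`
… By the pinning lemma and the independence of the two layers, the following event has
`ν̂`-probability at least `(θ/4)²` … together with Lemma 5.4 … there is a `≤∗`-path from `x` to `y`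
above `Δ`."

This file assembles the winding-type form of this claim from the tree: the combination theorem
`le_measureReal_goodAboveW_of_pinning[']` (`GoodAboveFromPinning`), the touching bound
`le_measureReal_touchAt` (`TouchingProbability`, replacing Lemma 5.4), the pinning bound
`exists_pinLeft_bound` (`PinLeftBound`, Lemma 5.2) and the anchoring of the four pinning structures
(`PinningAnchoring`, `CoexistenceAnchoring`), in the two orientations of the interface:

* **`exists_goodAboveW_bound_of_coexistence`** — for `β > β_c(2)`, a tail-trivial `μ ∈ 𝒢(β, 0)` under
  which both an infinite `+`cluster and an infinite `-`cluster of the upper half-plane exist almost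
  surely, and `s = ±1`: there is `c > 0` such that for every `m ≥ 1`, for all `a, b` large and then all
  `H` large, `c ≤ (μ ⊗ (μ ∘ θ_{s e₁}⁻¹))(A_{(-a,0),(b,0)}(m, H))`.

## References

* H.-O. Georgii, Y. Higuchi, J. Math. Phys. 41 (2000) 1153–1169, Lemma 5.5, proof, Case 3 (p. 15)
  [GeorgiiHiguchi2000].
-/

noncomputable section

open MeasureTheory Filter SimpleGraph
open Literature.Probability.Percolation
open scoped ENNReal

namespace Literature.Probability.LatticeModels

section Constants

/-- The constant `c₀ = (1 - (1 + e^{-8|β|}/2)⁻¹)/2` of the touching bound is positive. [folklore] -/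
theorem touchConst_toReal_pos (β : ℝ) :
    0 < ((1 - (1 + ENNReal.ofReal (Real.exp (-(8 * |β|)) / 2))⁻¹) / 2).toReal := by
  set δ : ℝ≥0∞ := ENNReal.ofReal (Real.exp (-(8 * |β|)) / 2) with hδ
  have hδ0 : δ ≠ 0 := by
    rw [hδ]; exact (ENNReal.ofReal_pos.2 (by positivity)).ne'
  have hlt : (1 + δ)⁻¹ < 1 := ENNReal.inv_lt_one.2 (ENNReal.lt_add_right ENNReal.one_ne_top hδ0)
  have hpos : 0 < 1 - (1 + δ)⁻¹ := tsub_pos_of_lt hlt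
  have hne : (1 - (1 + δ)⁻¹) / 2 ≠ 0 := (ENNReal.div_pos_iff.2 ⟨hpos.ne', ENNReal.ofNat_ne_top⟩).ne'
  have htop : (1 - (1 + δ)⁻¹) / 2 ≠ ⊤ :=
    ENNReal.div_ne_top (ne_top_of_le_ne_top ENNReal.one_ne_top tsub_le_self) two_ne_zero
  exact ENNReal.toReal_pos hne htop

end Constants

section Transports

variable {κ : Measure (SpinConfig (Site 2))}

/-- `+∗`percolation of `π_up` gives `+∗`percolation of the plane. [folklore] -/
theorem ae_plusStar_plane_of_halfPlane
    (h : ∀ᵐ ω ∂κ, ∃ x, (siteCluster zdStarGraph (spinSites 1 ω ∩ halfPlane 0) x).Infinite) :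
    ∀ᵐ ω ∂κ, ∃ x, (siteCluster zdStarGraph (spinSites 1 ω) x).Infinite := by
  filter_upwards [h] with ω ⟨x, hx⟩
  exact ⟨x, hx.mono (siteCluster_mono Set.inter_subset_left x)⟩

/-- `-∗`percolation of `π_up` for `κ` is `+∗`percolation of `π_up` for `κ ∘ (-)⁻¹`. [folklore] -/
theorem ae_plusStarUp_map_neg
    (h : ∀ᵐ ω ∂κ, ∃ x, (siteCluster zdStarGraph (spinSites (-1) ω ∩ halfPlane 0) x).Infinite) :
    ∀ᵐ ω ∂(κ.map fun σ : SpinConfig (Site 2) => -σ), ∃ x, (siteCluster zdStarGraph (spinSites 1 ω ∩ halfPlane 0) x).Infinite := by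
  have hmeas : MeasurableSet {ω : SpinConfig (Site 2) | ∃ x, (siteCluster zdStarGraph (spinSites 1 ω ∩ halfPlane 0) x).Infinite} :=
    MeasurableSet.of_tailEvents (measurableSet_tailEvents_existsInfClusterIn (G := zdStarGraph) 1 (halfPlane 0))
  rw [ae_map_iff measurable_neg.aemeasurable hmeas]
  filter_upwards [h] with ω hω
  show ∃ x, (siteCluster zdStarGraph (spinSites 1 (-ω) ∩ halfPlane 0) x).Infinite
  simpa only [spinSites_neg_config] using hω

/-- `+∗`percolation of `π_up` for `κ` is `+∗`percolation of `π_up` for `κ ∘ R₀⁻¹`. [folklore] -/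
theorem ae_plusStarUp_map_refl0
    (h : ∀ᵐ ω ∂κ, ∃ x, (siteCluster zdStarGraph (spinSites 1 ω ∩ halfPlane 0) x).Infinite) :
    ∀ᵐ ω ∂(κ.map refl0), ∃ x, (siteCluster zdStarGraph (spinSites 1 ω ∩ halfPlane 0) x).Infinite := by
  have hmeas : MeasurableSet {ω : SpinConfig (Site 2) | ∃ x, (siteCluster zdStarGraph (spinSites 1 ω ∩ halfPlane 0) x).Infinite} :=
    MeasurableSet.of_tailEvents (measurableSet_tailEvents_existsInfClusterIn (G := zdStarGraph) 1 (halfPlane 0))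
  let φ : zdStarGraph ≃g zdStarGraph :=
    { toEquiv := (reflectCoord (d := 2) 0).toEquiv
      map_rel_iff' := by
        intro a b
        constructor
        · intro h
          have h' := (starReflectHom 0).map_rel h
          rw [starReflectHom_apply, starReflectHom_apply] at h'
          have ea : reflectCoord 0 ((reflectCoord (d := 2) 0).toEquiv a) = a := reflectCoord_reflectCoord 0 a
          have eb : reflectCoord 0 ((reflectCoord (d := 2) 0).toEquiv b) = b := reflectCoord_reflectCoord 0 b
          rw [ea, eb] at h'
          exact h'
        · intro h
          exact (starReflectHom 0).map_rel h }
  have hφ1 : ∀ z : Site 2, (φ z) 1 = z 1 := fun z => (reflectCoord_zero_apply z).2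
  rw [ae_map_iff measurable_refl0.aemeasurable hmeas]
  filter_upwards [h] with ω ⟨x, hx⟩
  refine ⟨φ x, ?_⟩
  show (siteCluster zdStarGraph (spinSites 1 (configRelabel φ.toEquiv ω) ∩ halfPlane 0) (φ x)).Infinite
  rw [infinite_siteCluster_configRelabel_iff φ hφ1 1 ω x]; exact hx

/-- The orientation "`+`face on the left" is invariant under horizontal shifts. [folklore] -/
theorem ae_plusStar_axisUnboundedBelow_map_configShift_iff (t : ℤ) :
    (∀ᵐ ω ∂(κ.map (configShift (Pi.single 0 t : Site 2))), ∃ x, ∀ n : ℕ, ∃ k : ℤ, k < -(n : ℤ) ∧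
        (![k, 0] : Site 2) ∈ siteCluster zdStarGraph (spinSites 1 ω ∩ halfPlane 0) x) ↔
      ∀ᵐ ω ∂κ, ∃ x, ∀ n : ℕ, ∃ k : ℤ, k < -(n : ℤ) ∧
        (![k, 0] : Site 2) ∈ siteCluster zdStarGraph (spinSites 1 ω ∩ halfPlane 0) x := by
  rw [ae_map_iff (configShift _).measurable.aemeasurable
    (measurableSet_axisUnboundedBelow_config (G := zdStarGraph) 1 (halfPlane 0))]
  exact Filter.eventually_congr (Filter.Eventually.of_forall fun ω => exists_plusStar_axisUnboundedBelow_configShift_iff t ω)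

/-- The orientation "`+`face on the right" is invariant under horizontal shifts. [folklore] -/
theorem ae_plusStar_axisUnboundedAbove_map_configShift_iff (t : ℤ) :
    (∀ᵐ ω ∂(κ.map (configShift (Pi.single 0 t : Site 2))), ∃ x, ∀ n : ℕ, ∃ k : ℤ, (n : ℤ) < k ∧
        (![k, 0] : Site 2) ∈ siteCluster zdStarGraph (spinSites 1 ω ∩ halfPlane 0) x) ↔
      ∀ᵐ ω ∂κ, ∃ x, ∀ n : ℕ, ∃ k : ℤ, (n : ℤ) < k ∧
        (![k, 0] : Site 2) ∈ siteCluster zdStarGraph (spinSites 1 ω ∩ halfPlane 0) x := by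
  rw [ae_map_iff (configShift _).measurable.aemeasurable
    (measurableSet_axisUnboundedAbove_config (G := zdStarGraph) 1 (halfPlane 0))]
  exact Filter.eventually_congr (Filter.Eventually.of_forall fun ω => exists_plusStar_axisUnboundedAbove_configShift_iff t ω)

end Transports

section Main

variable {β : ℝ} {μ : Measure (SpinConfig (Site 2))}

/-- **Georgii–Higuchi 2000, Lemma 5.5, Case 3, winding form (contour-free proof).** For
`β > β_c(2)`, a tail-trivial `μ ∈ 𝒢(β, 0)` under which both an infinite `+`cluster and an infinite
`-`cluster of the upper half-plane exist almost surely, and `s = ±1`: there is `c > 0` such that for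
every `m ≥ 1` there are `a₀, b₀` with: for all `a ≥ a₀`, `b ≥ b₀` there is `H₀` with
`c ≤ (μ ⊗ (μ ∘ θ_{s e₁}⁻¹))(A_{(-a,0),(b,0)}(m, H))` for all `H ≥ H₀`. [cite: GeorgiiHiguchi2000, Lemma 5.5 (proof, Case 3)] -/
theorem exists_goodAboveW_bound_of_coexistence (hβc : criticalBeta 2 < β) (hμ : μ ∈ isingGibbsMeasures 2 β 0)
    (hμt : IsTailTrivial μ) (s : ℤˣ)
    (hP : ∀ᵐ ω ∂μ, ∃ x, (siteCluster (zdGraph 2) (spinSites 1 ω ∩ halfPlane 0) x).Infinite)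
    (hM : ∀ᵐ ω ∂μ, ∃ y, (siteCluster (zdGraph 2) (spinSites (-1) ω ∩ halfPlane 0) y).Infinite) :
    ∃ c : ℝ, 0 < c ∧ ∀ m : ℕ, 1 ≤ m → ∃ a₀ b₀ : ℕ, ∀ a b : ℕ, a₀ ≤ a → b₀ ≤ b → ∃ H₀ : ℕ, ∀ H : ℕ, H₀ ≤ H →
      c ≤ (μ.prod (μ.map (configShift (Pi.single 0 (s : ℤ))))).real
        {p | GoodAboveW m H (![-(a : ℤ), 0]) (![(b : ℤ), 0]) p} := by
  classical
  have hβ : 0 ≤ β := (criticalBeta_nonneg 2).trans hβc.le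
  have hμG : IsGibbsMeasure (isingSpecification (zdGraph 2) β 0) μ := hμ
  haveI := hμG.isProbabilityMeasure
  set θs := configShift (S := ℤˣ) (Pi.single (0 : Fin 2) (s : ℤ)) with hθs
  have hθm : Measurable θs := (configShift _).measurable
  set μ' : Measure (SpinConfig (Site 2)) := μ.map θs with hμ'
  have hμ'G : μ' ∈ isingGibbsMeasures 2 β 0 := mem_isingGibbsMeasures_map_configShift hμ _
  have hμ'GG : IsGibbsMeasure (isingSpecification (zdGraph 2) β 0) μ' := hμ'G
  haveI : IsProbabilityMeasure μ' := hμ'GG.isProbabilityMeasure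
  have hμ't : IsTailTrivial μ' := hμt.map_configRelabel (Site.shift _)
  -- the hypotheses for the translate
  have hP' : ∀ᵐ ω ∂μ', ∃ x, (siteCluster (zdGraph 2) (spinSites 1 ω ∩ halfPlane 0) x).Infinite := by
    rw [hμ', hθs, ae_exists_infinite_cluster_map_configShift_iff_lattice]; simpa using hP
  have hM' : ∀ᵐ ω ∂μ', ∃ y, (siteCluster (zdGraph 2) (spinSites (-1) ω ∩ halfPlane 0) y).Infinite := by
    rw [hμ', hθs, ae_exists_infinite_cluster_map_configShift_iff_lattice]; simpa using hM
  -- `±∗`percolation in `π_up`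
  have hD : ∀ᵐ ω ∂μ, ∃ x, (siteCluster zdStarGraph (spinSites 1 ω ∩ halfPlane 0) x).Infinite := by
    filter_upwards [hP] with ω ⟨x, hx⟩; exact ⟨x, infinite_starCluster_of_latticeCluster hx⟩
  have hD' : ∀ᵐ ω ∂μ', ∃ x, (siteCluster zdStarGraph (spinSites 1 ω ∩ halfPlane 0) x).Infinite := by
    filter_upwards [hP'] with ω ⟨x, hx⟩; exact ⟨x, infinite_starCluster_of_latticeCluster hx⟩
  have hMs : ∀ᵐ ω ∂μ, ∃ x, (siteCluster zdStarGraph (spinSites (-1) ω ∩ halfPlane 0) x).Infinite := by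
    filter_upwards [hM] with ω ⟨x, hx⟩; exact ⟨x, hx.mono (siteCluster_zd_subset_star _ x)⟩
  -- the touching bound
  set cT : ℝ := ((1 - (1 + ENNReal.ofReal (Real.exp (-(8 * |β|)) / 2))⁻¹) / 2).toReal with hcT
  have hcT0 : 0 < cT := touchConst_toReal_pos β
  have hT : ∀ n : ℕ, cT ≤ (μ.prod μ').real {p : SpinConfig (Site 2) × SpinConfig (Site 2) | TouchAt n p} :=
    fun n => le_measureReal_touchAt hβc hμ hμt s hP hM n
  -- transporting real lower bounds through `map`
  have real_map : ∀ {ν : Measure (SpinConfig (Site 2))} {f : SpinConfig (Site 2) → SpinConfig (Site 2)} (hf : Measurable f)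
      {E : Set (SpinConfig (Site 2))} (hE : MeasurableSet E), (ν.map f).real E = ν.real (f ⁻¹' E) := by
    intro ν f hf E hE
    rw [measureReal_def, Measure.map_apply hf hE, measureReal_def]
  -- orientation of the interface of `μ`
  rcases hμt.measure_axisUnboundedBelow (G := zdStarGraph) 1 (halfPlane 0) with h0 | h1
  · -- `+`face on the right: pin `x` by `-`sites of the first layer, `y` by `+`sites of the second
    have hR : ∀ᵐ ω ∂μ, ∃ x, ∀ n : ℕ, ∃ k : ℤ, (n : ℤ) < k ∧
        (![k, 0] : Site 2) ∈ siteCluster zdStarGraph (spinSites 1 ω ∩ halfPlane 0) x := by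
      filter_upwards [ae_axisUnbounded_below_or_above hβc hμ, measure_eq_zero_iff_ae_notMem.1 h0, hD]
        with ω hdich hnot ⟨x, hx⟩
      rcases hdich x hx with hb | ha
      · exact absurd ⟨x, hb⟩ hnot
      · exact ⟨x, ha⟩
    have hR' : ∀ᵐ ω ∂μ', ∃ x, ∀ n : ℕ, ∃ k : ℤ, (n : ℤ) < k ∧
        (![k, 0] : Site 2) ∈ siteCluster zdStarGraph (spinSites 1 ω ∩ halfPlane 0) x := by
      rw [hμ', hθs, ae_plusStar_axisUnboundedAbove_map_configShift_iff]; exact hR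
    -- the two pinning measures
    set κ₃ : Measure (SpinConfig (Site 2)) := μ.map (fun σ : SpinConfig (Site 2) => -σ) with hκ₃
    have hκ₃G : κ₃ ∈ isingGibbsMeasures 2 β 0 := isGibbsMeasure_map_neg (zdGraph 2) β hμG
    have hκ₃GG : IsGibbsMeasure (isingSpecification (zdGraph 2) β 0) κ₃ := hκ₃G
    haveI : IsProbabilityMeasure κ₃ := hκ₃GG.isProbabilityMeasure
    set κ₄ : Measure (SpinConfig (Site 2)) := μ'.map refl0 with hκ₄
    have hκ₄G : κ₄ ∈ isingGibbsMeasures 2 β 0 := IsGibbsMeasure.map_configRelabel _ (reflectCoord 0) hμ'GG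
    have hκ₄GG : IsGibbsMeasure (isingSpecification (zdGraph 2) β 0) κ₄ := hκ₄G
    haveI : IsProbabilityMeasure κ₄ := hκ₄GG.isProbabilityMeasure
    obtain ⟨z₃, hz₃⟩ := exists_pos_measureReal_plusStarCluster (κ := κ₃)
      (ae_plusStar_plane_of_halfPlane (ae_plusStarUp_map_neg hMs))
    obtain ⟨z₄, hz₄⟩ := exists_pos_measureReal_plusStarCluster (κ := κ₄)
      (ae_plusStar_plane_of_halfPlane (ae_plusStarUp_map_refl0 hD'))
    set θ₃ := κ₃.real {ω : SpinConfig (Site 2) | (siteCluster zdStarGraph (spinSites 1 ω) z₃).Infinite} with hθ₃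
    set θ₄ := κ₄.real {ω : SpinConfig (Site 2) | (siteCluster zdStarGraph (spinSites 1 ω) z₄).Infinite} with hθ₄
    refine ⟨cT * (θ₃ / 8) * (θ₄ / 8) / 2, by positivity, fun m hm => ?_⟩
    -- anchoring and the pinning bounds at scale `m`
    have hA₃ : ∀ᵐ ω ∂κ₃, LeftAnchoredInf m ω := by
      rw [hκ₃, ae_map_iff measurable_neg.aemeasurable (measurableSet_leftAnchoredInf (m := m))]
      exact ae_leftAnchoredInf_neg hβc hμ m (ae_minusStar_axisUnboundedBelow_of_right hβc hμ hR hM) hP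
    have hA₄ : ∀ᵐ ω ∂κ₄, LeftAnchoredInf m ω := by
      rw [hκ₄, ae_map_iff measurable_refl0.aemeasurable (measurableSet_leftAnchoredInf (m := m))]
      exact ae_leftAnchoredInf_refl0 hβc hμ'G m hR' hM'
    obtain ⟨a₀, ha₀⟩ := exists_pinLeft_bound hβ hκ₃G hθ₃.symm.le m hA₃
    obtain ⟨b₀, hb₀⟩ := exists_pinLeft_bound hβ hκ₄G hθ₄.symm.le m hA₄
    refine ⟨a₀, b₀, fun a b ha hb => ?_⟩
    have hpx : θ₃ / 8 ≤ μ.real {ω : SpinConfig (Site 2) | PinLeft m (![-(a : ℤ), 0]) (-ω)} := by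
      have h := ha₀ (![-(a : ℤ), 0]) (by simp) (by simp; omega)
      rwa [hκ₃, real_map measurable_neg (measurableSet_pinLeft (m := m) _)] at h
    have hpy : θ₄ / 8 ≤ μ'.real {ω : SpinConfig (Site 2) | PinRightPlus m (![(b : ℤ), 0]) ω} := by
      have hRy : reflectCoord (d := 2) 0 (![(b : ℤ), 0] : Site 2) = ![-(b : ℤ), 0] := by
        funext j; rw [reflectCoord_apply]; fin_cases j <;> simp
      have h := hb₀ (![-(b : ℤ), 0]) (by simp) (by simp; omega)
      rw [hκ₄, real_map measurable_refl0 (measurableSet_pinLeft (m := m) _)] at h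
      have hset : (refl0 ⁻¹' {ω : SpinConfig (Site 2) | PinLeft m (![-(b : ℤ), 0]) ω}) =
          {ω : SpinConfig (Site 2) | PinRightPlus m (![(b : ℤ), 0]) ω} := by
        ext ω; simp only [Set.mem_preimage, Set.mem_setOf_eq, PinRightPlus, hRy]
      rwa [hset] at h
    obtain ⟨H₀, hH₀⟩ := le_measureReal_goodAboveW_of_pinning' hβc hμ hμt hμ'G hμ't hm (Nat.lt_succ_self m)
      (![-(a : ℤ), 0]) (![(b : ℤ), 0]) (by simp) (by positivity) (by positivity) (hT (m + 1)) hpx hpy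
      (ε := cT * (θ₃ / 8) * (θ₄ / 8) / 2) (by positivity)
    exact ⟨H₀, fun H hH => by have := hH₀ H hH; linarith⟩
  · -- `+`face on the left: pin `x` by `+`sites of the second layer, `y` by `-`sites of the first
    have hL : ∀ᵐ ω ∂μ, ∃ x, ∀ n : ℕ, ∃ k : ℤ, k < -(n : ℤ) ∧
        (![k, 0] : Site 2) ∈ siteCluster zdStarGraph (spinSites 1 ω ∩ halfPlane 0) x := by
      have := (prob_compl_eq_zero_iff (measurableSet_axisUnboundedBelow_config (G := zdStarGraph) 1 (halfPlane 0))).2 h1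
      filter_upwards [measure_eq_zero_iff_ae_notMem.1 this] with ω hω
      exact not_not.1 hω
    have hL' : ∀ᵐ ω ∂μ', ∃ x, ∀ n : ℕ, ∃ k : ℤ, k < -(n : ℤ) ∧
        (![k, 0] : Site 2) ∈ siteCluster zdStarGraph (spinSites 1 ω ∩ halfPlane 0) x := by
      rw [hμ', hθs, ae_plusStar_axisUnboundedBelow_map_configShift_iff]; exact hL
    set κ₂ : Measure (SpinConfig (Site 2)) := μ.map negRefl with hκ₂
    have hfun : (negRefl : SpinConfig (Site 2) → SpinConfig (Site 2)) = refl0 ∘ (fun σ : SpinConfig (Site 2) => -σ) := by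
      funext σ; exact negRefl_eq_refl0_neg σ
    have hκ₂eq : κ₂ = (μ.map (fun σ : SpinConfig (Site 2) => -σ)).map refl0 := by
      rw [hκ₂, hfun, Measure.map_map measurable_refl0 measurable_neg]
    have hκ₂G : κ₂ ∈ isingGibbsMeasures 2 β 0 := by
      rw [hκ₂eq]
      exact IsGibbsMeasure.map_configRelabel _ (reflectCoord 0) (isGibbsMeasure_map_neg (zdGraph 2) β hμG)
    have hκ₂GG : IsGibbsMeasure (isingSpecification (zdGraph 2) β 0) κ₂ := hκ₂G
    haveI : IsProbabilityMeasure κ₂ := hκ₂GG.isProbabilityMeasure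
    obtain ⟨z₁, hz₁⟩ := exists_pos_measureReal_plusStarCluster (κ := μ') (ae_plusStar_plane_of_halfPlane hD')
    obtain ⟨z₂, hz₂⟩ := exists_pos_measureReal_plusStarCluster (κ := κ₂)
      (ae_plusStar_plane_of_halfPlane (by rw [hκ₂eq]; exact ae_plusStarUp_map_refl0 (ae_plusStarUp_map_neg hMs)))
    set θ₁ := μ'.real {ω : SpinConfig (Site 2) | (siteCluster zdStarGraph (spinSites 1 ω) z₁).Infinite} with hθ₁
    set θ₂ := κ₂.real {ω : SpinConfig (Site 2) | (siteCluster zdStarGraph (spinSites 1 ω) z₂).Infinite} with hθ₂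
    refine ⟨cT * (θ₁ / 8) * (θ₂ / 8) / 2, by positivity, fun m hm => ?_⟩
    have hA₁ : ∀ᵐ ω ∂μ', LeftAnchoredInf m ω := ae_leftAnchoredInf hβc hμ'G m hL' hM'
    have hA₂ : ∀ᵐ ω ∂κ₂, LeftAnchoredInf m ω := by
      rw [hκ₂, ae_map_iff measurable_negRefl.aemeasurable (measurableSet_leftAnchoredInf (m := m))]
      exact ae_leftAnchoredInf_negRefl hβc hμ m (ae_minusStar_axisUnboundedAbove_of_left hβc hμ hL hM) hP
    obtain ⟨a₀, ha₀⟩ := exists_pinLeft_bound hβ hμ'G hθ₁.symm.le m hA₁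
    obtain ⟨b₀, hb₀⟩ := exists_pinLeft_bound hβ hκ₂G hθ₂.symm.le m hA₂
    refine ⟨a₀, b₀, fun a b ha hb => ?_⟩
    have hpx : θ₁ / 8 ≤ μ'.real {ω : SpinConfig (Site 2) | PinLeft m (![-(a : ℤ), 0]) ω} :=
      ha₀ (![-(a : ℤ), 0]) (by simp) (by simp; omega)
    have hpy : θ₂ / 8 ≤ μ.real {ω : SpinConfig (Site 2) | PinRightMinus m (![(b : ℤ), 0]) ω} := by
      have hRy : reflectCoord (d := 2) 0 (![(b : ℤ), 0] : Site 2) = ![-(b : ℤ), 0] := by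
        funext j; rw [reflectCoord_apply]; fin_cases j <;> simp
      have h := hb₀ (![-(b : ℤ), 0]) (by simp) (by simp; omega)
      rw [hκ₂, real_map measurable_negRefl (measurableSet_pinLeft (m := m) _)] at h
      have hset : (negRefl ⁻¹' {ω : SpinConfig (Site 2) | PinLeft m (![-(b : ℤ), 0]) ω}) =
          {ω : SpinConfig (Site 2) | PinRightMinus m (![(b : ℤ), 0]) ω} := by
        ext ω; simp only [Set.mem_preimage, Set.mem_setOf_eq, PinRightMinus, hRy]
      rwa [hset] at h
    obtain ⟨H₀, hH₀⟩ := le_measureReal_goodAboveW_of_pinning hβc hμ hμt hμ'G hμ't hm (Nat.lt_succ_self m)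
      (![-(a : ℤ), 0]) (![(b : ℤ), 0]) (by simp) (by positivity) (by positivity) (hT (m + 1)) hpx hpy
      (ε := cT * (θ₁ / 8) * (θ₂ / 8) / 2) (by positivity)
    exact ⟨H₀, fun H hH => by have := hH₀ H hH; linarith⟩

end Main

end Literature.Probability.LatticeModels
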